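import Summits.CriticalPhenomena.PercolationContinuityZ3.Theorems.PercNearOneGluingNoHeavyLowerTailSuperTerminalP3HalfGluing
import Summits.CriticalPhenomena.PercolationContinuityZ3.Theorems.PercNearOneGluingNoHeavyLowerTailSuperTerminalP3LamGluing
import HarnessLib

/-!
# `P3½` and `P3_λ` (`λ ≥ 8/5`) reduce to `{s,a,b,c}`-PRIME weighted graphs (component labelling made explicit)

Support file for crux `stmt-CriticalPhenomena-4575` (`NoHeavyLowerTail`), seat `prim-l12-p1` gen 32 (`--supports stmt-CriticalPhenomena-4575`);
corollaries of the graph-level THEOREMS C / C′ (`SuperTerminalP3HalfGluing.p3half_of_pieces`, `SuperTerminalP3LamGluing.p3lam_of_pieces`).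
No definitions, no sorries, standard axioms.

A weight `u` on `V` is PRIME for the terminals `s, a, b, c` (written out inline, no definition): it vanishes on the six terminal pairs, and
its active non-terminal vertices (those on a pair of non-zero weight) are pairwise joined by paths of non-terminal vertices along pairs of
non-zero weight (one internal component).  `p3half_of_primes` / `p3lam_of_primes`: **if the row holds for every prime RESTRICTION `u` of `w`
(`u = w` on the support of `u`), it holds for `w`** — take `part :=` the connected components of the graph of non-zero non-terminal pairs of
`w` (`SimpleGraph.connectedComponentMk`), check the splitting hypothesis (different components span weight-zero pairs) and that every piece
weight `w·1_{pairs of piece i}` is prime (an active vertex of the piece lies in component `i`; an `H`-walk inside the component is a walk of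
non-zero piece pairs), and apply the pieces theorem.  So a counterexample with the fewest active vertices is prime, for `P3½` and for every
`P3_λ`, `λ ≥ 8/5`.
-/

namespace Summit.CriticalPhenomena.PercolationContinuityZ3.Theorems.SuperTerminalPrimeReduction

open MeasureTheory Set
open Literature.Probability.Percolation Literature.Probability.Percolation.PartitionGluing
open Literature.Probability.LatticeModels (prodBernoulli)
open SuperTerminalP3HalfGluing
open scoped Classical

variable {V : Type*} [Fintype V] {s a b c : V}

/-- **Reduction of `P3½` to `{s,a,b,c}`-PRIME weighted graphs.**  Call a weight `u` on `V` prime (for the terminals `s,a,b,c`) if it vanishes on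
the six terminal pairs and its ACTIVE non-terminal vertices (those on a pair of non-zero weight) are pairwise joined by paths of non-terminal
vertices along pairs of non-zero weight — one internal component, no terminal–terminal edge.  If `P3½` holds for every prime restriction `u` of `w`
(`u = w` on the support of `u`), then `P3½` holds for `w`: apply `p3half_of_pieces` to the labelling of `V` by the connected components of the graph
of non-zero non-terminal pairs of `w`; each piece weight `w·1_{pairs of piece i}` is prime.  Hence a counterexample to `P3½` with the fewest
active vertices is prime. [this work] -/
theorem p3half_of_primes (w : Sym2 V → unitInterval) (hd : s ≠ a ∧ s ≠ b ∧ s ≠ c ∧ a ≠ b ∧ a ≠ c ∧ b ≠ c)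
    (hprime : ∀ u : Sym2 V → unitInterval,
      (∀ e, (u e : ℝ) ≠ 0 → u e = w e) →
      (∀ x y : V, (x = s ∨ x = a ∨ x = b ∨ x = c) → (y = s ∨ y = a ∨ y = b ∨ y = c) → (u s(x, y) : ℝ) = 0) →
      (∀ x y : V, ¬ (x = s ∨ x = a ∨ x = b ∨ x = c) → ¬ (y = s ∨ y = a ∨ y = b ∨ y = c) →
        (∃ z, (u s(x, z) : ℝ) ≠ 0) → (∃ z, (u s(y, z) : ℝ) ≠ 0) →
        (SimpleGraph.fromRel fun p q : V =>
            ¬ (p = s ∨ p = a ∨ p = b ∨ p = c) ∧ ¬ (q = s ∨ q = a ∨ q = b ∨ q = c) ∧ (u s(p, q) : ℝ) ≠ 0).Reachable x y) →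
      (prodBernoulli u).real (openConn s a ∩ (openConn s b)ᶜ : Set (BondConfig V)) *
          (prodBernoulli u).real ((openConn c s)ᶜ ∩ (openConn c a)ᶜ ∩ (openConn c b)ᶜ : Set (BondConfig V))ᶜ ≤
        2 * (prodBernoulli u).real (openConn s a ∩ (openConn s b)ᶜ ∩ ((openConn c s)ᶜ ∩ (openConn c a)ᶜ ∩ (openConn c b)ᶜ)ᶜ : Set (BondConfig V))) :
    (prodBernoulli w).real (openConn s a ∩ (openConn s b)ᶜ : Set (BondConfig V)) *
        (prodBernoulli w).real ((openConn c s)ᶜ ∩ (openConn c a)ᶜ ∩ (openConn c b)ᶜ : Set (BondConfig V))ᶜ ≤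
      2 * (prodBernoulli w).real (openConn s a ∩ (openConn s b)ᶜ ∩ ((openConn c s)ᶜ ∩ (openConn c a)ᶜ ∩ (openConn c b)ᶜ)ᶜ : Set (BondConfig V)) := by
  -- the terminal set and the graph of non-zero non-terminal pairs
  have hT : ∀ x : V, x ∈ ({s, a, b, c} : Finset V) ↔ (x = s ∨ x = a ∨ x = b ∨ x = c) := fun x => by
    simp only [Finset.mem_insert, Finset.mem_singleton]
  set H : SimpleGraph V := SimpleGraph.fromRel fun p q : V =>
      ¬ (p = s ∨ p = a ∨ p = b ∨ p = c) ∧ ¬ (q = s ∨ q = a ∨ q = b ∨ q = c) ∧ (w s(p, q) : ℝ) ≠ 0 with hH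
  haveI : Fintype H.ConnectedComponent := Fintype.ofFinite _
  refine p3half_of_pieces w hd (fun v => H.connectedComponentMk v) ?_ ?_
  · -- splitting: non-terminals in different components span a weight-zero pair
    intro x y hx hy hxy
    by_contra hne
    apply hxy
    rw [SimpleGraph.ConnectedComponent.eq]
    by_cases hxy' : x = y
    · subst hxy'; rfl
    refine SimpleGraph.Adj.reachable ?_
    rw [hH, SimpleGraph.fromRel_adj]
    exact ⟨hxy', Or.inl ⟨fun h => hx ((hT x).2 h), fun h => hy ((hT y).2 h), hne⟩⟩
  · -- every piece weight is prime
    intro i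
    apply hprime
    · intro e he
      by_cases h : e ∈ piecePairs {s, a, b, c} (fun v => H.connectedComponentMk v) i
      · simp [h]
      · exfalso; apply he; simp [h]
    · intro x y hx hy
      have : s(x, y) ∉ piecePairs {s, a, b, c} (fun v => H.connectedComponentMk v) i :=
        termPair_not_mem_piecePairs ((hT x).2 hx) ((hT y).2 hy)
      simp [this]
    · intro x y hx hy hxz hyz
      -- an active non-terminal of piece `i` lies in the component `i`
      have act : ∀ v : V, ¬ (v = s ∨ v = a ∨ v = b ∨ v = c) →
          (∃ z, ((fun e => if e ∈ piecePairs {s, a, b, c} (fun v => H.connectedComponentMk v) i then w e else 0) s(v, z) : ℝ) ≠ 0) →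
          H.connectedComponentMk v = i := by
        rintro v hv ⟨z, hz⟩
        by_cases hmem : s(v, z) ∈ piecePairs {s, a, b, c} (fun v => H.connectedComponentMk v) i
        · obtain ⟨p, q, ⟨hp, hpi⟩, hq, -, hpq⟩ := mem_piecePairs.1 hmem
          rcases Sym2.eq_iff.1 hpq with ⟨rfl, -⟩ | ⟨rfl, rfl⟩
          · exact hpi
          · rcases hq with ⟨-, hqi⟩ | hq
            · exact hqi
            · exact (hv ((hT _).1 hq)).elim
        · exact (hz (by simp [hmem])).elim
      have hxi := act x hx hxz
      have hyi := act y hy hyz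
      have hreach : H.Reachable x y := SimpleGraph.ConnectedComponent.eq.1 (hxi.trans hyi.symm)
      -- transport an `H`-walk inside the component `i` to the graph of the piece weight
      obtain ⟨p⟩ := hreach
      suffices key : ∀ {x' y' : V} (q : H.Walk x' y'), H.connectedComponentMk x' = i →
          (SimpleGraph.fromRel fun p q : V => ¬ (p = s ∨ p = a ∨ p = b ∨ p = c) ∧ ¬ (q = s ∨ q = a ∨ q = b ∨ q = c) ∧
            ((fun e => if e ∈ piecePairs {s, a, b, c} (fun v => H.connectedComponentMk v) i then w e else 0) s(p, q) : ℝ) ≠ 0).Reachable x' y' from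
        key p hxi
      intro x' y' q
      induction q with
      | nil => exact fun _ => SimpleGraph.Reachable.refl _
      | @cons u v _ hadj _ ih =>
        intro hui
        have hadj' := hadj
        rw [hH, SimpleGraph.fromRel_adj] at hadj'
        obtain ⟨huv, hrel⟩ := hadj'
        have hvi : H.connectedComponentMk v = i := by
          rw [← hui]; exact (SimpleGraph.ConnectedComponent.eq.2 (SimpleGraph.Adj.reachable hadj)).symm
        have hu' : ¬ (u = s ∨ u = a ∨ u = b ∨ u = c) := by rcases hrel with ⟨h, -, -⟩ | ⟨-, h, -⟩ <;> exact h
        have hv' : ¬ (v = s ∨ v = a ∨ v = b ∨ v = c) := by rcases hrel with ⟨-, h, -⟩ | ⟨h, -, -⟩ <;> exact h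
        have hw0 : (w s(u, v) : ℝ) ≠ 0 := by
          rcases hrel with ⟨-, -, h⟩ | ⟨-, -, h⟩
          · exact h
          · rw [Sym2.eq_swap]; exact h
        have hmem : s(u, v) ∈ piecePairs {s, a, b, c} (fun v => H.connectedComponentMk v) i :=
          mk_mem_piecePairs (fun h => hu' ((hT u).1 h)) hui (Or.inl ⟨fun h => hv' ((hT v).1 h), hvi⟩) huv
        refine SimpleGraph.Reachable.trans (SimpleGraph.Adj.reachable ?_) (ih hvi)
        rw [SimpleGraph.fromRel_adj]
        refine ⟨huv, Or.inl ⟨hu', hv', ?_⟩⟩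
        simp only [hmem, if_true]
        exact hw0


/-- **Reduction of `P3_λ` (`λ ≥ 8/5`) to `{s,a,b,c}`-PRIME weighted graphs.**  Call a weight `u` on `V` prime (for the terminals `s,a,b,c`) if it vanishes on
the six terminal pairs and its ACTIVE non-terminal vertices (those on a pair of non-zero weight) are pairwise joined by paths of non-terminal
vertices along pairs of non-zero weight — one internal component, no terminal–terminal edge.  If `P3_λ` (`λ ≥ 8/5`) holds for every prime restriction `u` of `w`
(`u = w` on the support of `u`), then `P3_λ` holds for `w`: apply `SuperTerminalP3LamGluing.p3lam_of_pieces` to the labelling of `V` by the connected components of the graph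
of non-zero non-terminal pairs of `w`; each piece weight `w·1_{pairs of piece i}` is prime.  Hence for every `λ ≥ 8/5` a counterexample to `P3_λ` with the fewest active vertices is prime. [this work] -/
theorem p3lam_of_primes {lam : ℝ} (hlam : 8 / 5 ≤ lam) (w : Sym2 V → unitInterval) (hd : s ≠ a ∧ s ≠ b ∧ s ≠ c ∧ a ≠ b ∧ a ≠ c ∧ b ≠ c)
    (hprime : ∀ u : Sym2 V → unitInterval,
      (∀ e, (u e : ℝ) ≠ 0 → u e = w e) →
      (∀ x y : V, (x = s ∨ x = a ∨ x = b ∨ x = c) → (y = s ∨ y = a ∨ y = b ∨ y = c) → (u s(x, y) : ℝ) = 0) →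
      (∀ x y : V, ¬ (x = s ∨ x = a ∨ x = b ∨ x = c) → ¬ (y = s ∨ y = a ∨ y = b ∨ y = c) →
        (∃ z, (u s(x, z) : ℝ) ≠ 0) → (∃ z, (u s(y, z) : ℝ) ≠ 0) →
        (SimpleGraph.fromRel fun p q : V =>
            ¬ (p = s ∨ p = a ∨ p = b ∨ p = c) ∧ ¬ (q = s ∨ q = a ∨ q = b ∨ q = c) ∧ (u s(p, q) : ℝ) ≠ 0).Reachable x y) →
      (prodBernoulli u).real (openConn s a ∩ (openConn s b)ᶜ : Set (BondConfig V)) *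
          (prodBernoulli u).real ((openConn c s)ᶜ ∩ (openConn c a)ᶜ ∩ (openConn c b)ᶜ : Set (BondConfig V))ᶜ ≤
        lam * (prodBernoulli u).real (openConn s a ∩ (openConn s b)ᶜ ∩ ((openConn c s)ᶜ ∩ (openConn c a)ᶜ ∩ (openConn c b)ᶜ)ᶜ : Set (BondConfig V))) :
    (prodBernoulli w).real (openConn s a ∩ (openConn s b)ᶜ : Set (BondConfig V)) *
        (prodBernoulli w).real ((openConn c s)ᶜ ∩ (openConn c a)ᶜ ∩ (openConn c b)ᶜ : Set (BondConfig V))ᶜ ≤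
      lam * (prodBernoulli w).real (openConn s a ∩ (openConn s b)ᶜ ∩ ((openConn c s)ᶜ ∩ (openConn c a)ᶜ ∩ (openConn c b)ᶜ)ᶜ : Set (BondConfig V)) := by
  -- the terminal set and the graph of non-zero non-terminal pairs
  have hT : ∀ x : V, x ∈ ({s, a, b, c} : Finset V) ↔ (x = s ∨ x = a ∨ x = b ∨ x = c) := fun x => by
    simp only [Finset.mem_insert, Finset.mem_singleton]
  set H : SimpleGraph V := SimpleGraph.fromRel fun p q : V =>
      ¬ (p = s ∨ p = a ∨ p = b ∨ p = c) ∧ ¬ (q = s ∨ q = a ∨ q = b ∨ q = c) ∧ (w s(p, q) : ℝ) ≠ 0 with hH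
  haveI : Fintype H.ConnectedComponent := Fintype.ofFinite _
  refine SuperTerminalP3LamGluing.p3lam_of_pieces hlam w hd (fun v => H.connectedComponentMk v) ?_ ?_
  · -- splitting: non-terminals in different components span a weight-zero pair
    intro x y hx hy hxy
    by_contra hne
    apply hxy
    rw [SimpleGraph.ConnectedComponent.eq]
    by_cases hxy' : x = y
    · subst hxy'; rfl
    refine SimpleGraph.Adj.reachable ?_
    rw [hH, SimpleGraph.fromRel_adj]
    exact ⟨hxy', Or.inl ⟨fun h => hx ((hT x).2 h), fun h => hy ((hT y).2 h), hne⟩⟩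
  · -- every piece weight is prime
    intro i
    apply hprime
    · intro e he
      by_cases h : e ∈ piecePairs {s, a, b, c} (fun v => H.connectedComponentMk v) i
      · simp [h]
      · exfalso; apply he; simp [h]
    · intro x y hx hy
      have : s(x, y) ∉ piecePairs {s, a, b, c} (fun v => H.connectedComponentMk v) i :=
        termPair_not_mem_piecePairs ((hT x).2 hx) ((hT y).2 hy)
      simp [this]
    · intro x y hx hy hxz hyz
      -- an active non-terminal of piece `i` lies in the component `i`
      have act : ∀ v : V, ¬ (v = s ∨ v = a ∨ v = b ∨ v = c) →
          (∃ z, ((fun e => if e ∈ piecePairs {s, a, b, c} (fun v => H.connectedComponentMk v) i then w e else 0) s(v, z) : ℝ) ≠ 0) →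
          H.connectedComponentMk v = i := by
        rintro v hv ⟨z, hz⟩
        by_cases hmem : s(v, z) ∈ piecePairs {s, a, b, c} (fun v => H.connectedComponentMk v) i
        · obtain ⟨p, q, ⟨hp, hpi⟩, hq, -, hpq⟩ := mem_piecePairs.1 hmem
          rcases Sym2.eq_iff.1 hpq with ⟨rfl, -⟩ | ⟨rfl, rfl⟩
          · exact hpi
          · rcases hq with ⟨-, hqi⟩ | hq
            · exact hqi
            · exact (hv ((hT _).1 hq)).elim
        · exact (hz (by simp [hmem])).elim
      have hxi := act x hx hxz
      have hyi := act y hy hyz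
      have hreach : H.Reachable x y := SimpleGraph.ConnectedComponent.eq.1 (hxi.trans hyi.symm)
      -- transport an `H`-walk inside the component `i` to the graph of the piece weight
      obtain ⟨p⟩ := hreach
      suffices key : ∀ {x' y' : V} (q : H.Walk x' y'), H.connectedComponentMk x' = i →
          (SimpleGraph.fromRel fun p q : V => ¬ (p = s ∨ p = a ∨ p = b ∨ p = c) ∧ ¬ (q = s ∨ q = a ∨ q = b ∨ q = c) ∧
            ((fun e => if e ∈ piecePairs {s, a, b, c} (fun v => H.connectedComponentMk v) i then w e else 0) s(p, q) : ℝ) ≠ 0).Reachable x' y' from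
        key p hxi
      intro x' y' q
      induction q with
      | nil => exact fun _ => SimpleGraph.Reachable.refl _
      | @cons u v _ hadj _ ih =>
        intro hui
        have hadj' := hadj
        rw [hH, SimpleGraph.fromRel_adj] at hadj'
        obtain ⟨huv, hrel⟩ := hadj'
        have hvi : H.connectedComponentMk v = i := by
          rw [← hui]; exact (SimpleGraph.ConnectedComponent.eq.2 (SimpleGraph.Adj.reachable hadj)).symm
        have hu' : ¬ (u = s ∨ u = a ∨ u = b ∨ u = c) := by rcases hrel with ⟨h, -, -⟩ | ⟨-, h, -⟩ <;> exact h
        have hv' : ¬ (v = s ∨ v = a ∨ v = b ∨ v = c) := by rcases hrel with ⟨-, h, -⟩ | ⟨h, -, -⟩ <;> exact h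
        have hw0 : (w s(u, v) : ℝ) ≠ 0 := by
          rcases hrel with ⟨-, -, h⟩ | ⟨-, -, h⟩
          · exact h
          · rw [Sym2.eq_swap]; exact h
        have hmem : s(u, v) ∈ piecePairs {s, a, b, c} (fun v => H.connectedComponentMk v) i :=
          mk_mem_piecePairs (fun h => hu' ((hT u).1 h)) hui (Or.inl ⟨fun h => hv' ((hT v).1 h), hvi⟩) huv
        refine SimpleGraph.Reachable.trans (SimpleGraph.Adj.reachable ?_) (ih hvi)
        rw [SimpleGraph.fromRel_adj]
        refine ⟨huv, Or.inl ⟨hu', hv', ?_⟩⟩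
        simp only [hmem, if_true]
        exact hw0


end Summit.CriticalPhenomena.PercolationContinuityZ3.Theorems.SuperTerminalPrimeReduction
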